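import Literature.AlgebraicGeometry.HodgeTheory.SymmetricA3SingularBridge
import Literature.AlgebraicGeometry.HodgeTheory.SymmetricA3ReducedChart
import Literature.AlgebraicGeometry.HodgeTheory.SymmetricA3FarSingularPoints
import Literature.AlgebraicGeometry.HodgeTheory.PicardLefschetzSymmetricA3Junction
import Literature.Geometry.ComplexAnalytic.EvenQuarticWeierstrassBranches
import Literature.Geometry.ComplexAnalytic.EvenQuarticWeierstrassNodes
import HarnessLib

/-!
# The bifurcation half of F-B2PL, PROVED: every symmetric `A₃` datum admits bifurcation data
# (`IsSymmetricA3Datum.exists_isSymmetricA3Bifurcation`; programme B2-BIF, assembly S7)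

Family `hodge`, layer `Literature/AlgebraicGeometry/HodgeTheory`.  Written by the prover seat `hodge-nonav-19716-p2` (g8,
cell `hodge-nonav`), assembling the programme B2-BIF of the cell (`prover-Bx` g12: slice chart, equivariance, reduced
chart, kernel-line jets, axis member; `19716-p2` g8: far singular points, ordinary-double-point criteria, even quartic
Weierstrass preparation / branches / nodes, reduced-function jets, junction) into conclusion (i) of the named fact hB2 =
`picardLefschetz_symmetricA3` of crux K1-B of `Summits/HodgeConjecture/HodgeConjecture/Theses/SignSymmetricPowers.lean`
(stmt-HodgeConjecture-19716):

* `IsSymmetricA3Datum.exists_isSymmetricA3Bifurcation` — for forms `f₁, g₀, g₂` of degree `d` and a symmetric `A₃` datum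
  `IsSymmetricA3Datum f₁ g₀ g₂ j k a` there are `εa, εb > 0` and `ψ` holomorphic on `|a| < εa` with
  `IsSymmetricA3Bifurcation f₁ g₀ g₂ j a εa εb ψ`: on `|a| < εa, |b| < εb` the member `f₁ + a g₂ + b g₀` is nonsingular
  iff `b ∉ {0, ψ(a)}`; for `a ≠ 0` the member `b = 0` has exactly one node, at `e_j`, and the member `b = ψ(a)` exactly
  two nodes, exchanged by the involution `a` (AGZV II §5.2: the level bifurcation set of the boundary singularity `B₂` is
  `λ₂ = 0 ∪ λ₁² = 4λ₂`, read through the substitution `(a, b) ↦ (λ₁, λ₂)`);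
* `picardLefschetz_symmetricA3_of_PL` — consequently hB2 follows from its Picard–Lefschetz half alone (the registry's
  re-cut of the binder, via `picardLefschetz_symmetricA3_of_bifurcation`).

Nothing here says HC ∕ HC_AV is proved; the Picard–Lefschetz half of hB2 remains a named-fact-shaped hypothesis.

## References
* [ArnoldGuseinzadeVarchenko2012] V. I. Arnold, S. M. Gusein-Zade, A. N. Varchenko, *Singularities of Differentiable
  Maps, Volume 2*, Birkhäuser 2012, Part I §5.2 (pp. 129–133 of the held text, fig. 48).
* [Arnold1981] V. I. Arnold, *Singularity Theory*, LMS LNS 53, CUP 1981, Theorem 2 (bifurcation diagrams of `B_μ`), p. 247.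
* [VoisinHodgeII2003] C. Voisin, *Hodge Theory and Complex Algebraic Geometry II*, CUP 2003, §2.1.1, §2.3.1.
-/

noncomputable section

open MvPolynomial Metric Set Filter
open scoped Topology
open Literature.AlgebraicGeometry.Motives Literature.Geometry.ComplexAnalytic.BoundarySingularity

namespace Literature.AlgebraicGeometry.HodgeTheory

open DiscriminantBranches

section HodgeTheory

variable {n d : ℕ} {f₁ g₀ g₂ : MvPolynomial (Fin (n + 2)) ℂ} {j k : Fin (n + 2)} {a : Fin (n + 2) → ℂˣ}

/-- Extracting a radius from an `∀ᶠ` statement at `0` in a normed group. [folklore] -/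
private theorem exists_ball_of_eventually {E : Type*} [SeminormedAddCommGroup E] {P : E → Prop}
    (h : ∀ᶠ x in 𝓝 (0 : E), P x) : ∃ ε > 0, ∀ x : E, ‖x‖ < ε → P x := by
  obtain ⟨ε, hε, hb⟩ := Metric.eventually_nhds_iff.1 h
  exact ⟨ε, hε, fun x hx => hb (by rwa [dist_zero_right])⟩

/-- Extracting a radius from an `∀ᶠ` statement on a punctured neighbourhood of `0`. [folklore] -/
private theorem exists_ball_of_eventually_punctured {P : ℂ → Prop} (h : ∀ᶠ x in 𝓝[≠] (0 : ℂ), P x) :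
    ∃ ε > 0, ∀ x : ℂ, ‖x‖ < ε → x ≠ 0 → P x := by
  rw [eventually_nhdsWithin_iff] at h
  obtain ⟨ε, hε, hb⟩ := Metric.eventually_nhds_iff.1 h
  exact ⟨ε, hε, fun x hx hx0 => hb (by rwa [dist_zero_right]) hx0⟩

/-- The sup norm of a pair of complex numbers. [folklore] -/
private theorem norm_mk_lt {α β : ℂ} {ε : ℝ} (hα : ‖α‖ < ε) (hβ : ‖β‖ < ε) : ‖((α, β) : ℂ × ℂ)‖ < ε := by
  rw [Prod.norm_def]; exact max_lt hα hβ

namespace IsSymmetricA3Datum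

/-- **The bifurcation half of F-B2PL: every symmetric `A₃` datum admits bifurcation data.**  For forms `f₁, g₀, g₂` of
degree `d` on `ℙⁿ⁺¹_ℂ` with `IsSymmetricA3Datum f₁ g₀ g₂ j k a` there exist `εa, εb > 0` and `ψ` holomorphic on
`|a| < εa`, `ψ(0) = 0`, `ψ(a) ≠ 0` for `a ≠ 0`, `2|ψ(a)| < εb`, such that for `|a| < εa`, `|b| < εb` the member
`f₁ + a g₂ + b g₀` is nonsingular iff `b ≠ 0` and `b ≠ ψ(a)`, the member `b = 0` (`a ≠ 0`) has exactly one node, at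
`e_j`, and the member `b = ψ(a)` exactly two nodes exchanged by `a` — AGZV II §5.2 for the boundary singularity `B₂`
(`λ₂ = 0`: one critical point with critical value zero on the boundary; `λ₁² = 4λ₂`: a symmetric pair), obtained here by
Weierstrass preparation of the EVEN reduced function (`u⁴ + λ₁u² + λ₂` times a unit) and the holomorphic implicit function
theorem in the `(a, b)`-plane. [cite: ArnoldGuseinzadeVarchenko2012, Part I §5.2 (pp. 132–133, fig. 48)]
[cite: Arnold1981, Theorem 2 and the Remark before it, p. 247] [cite: VoisinHodgeII2003, §2.3.1] -/
theorem exists_isSymmetricA3Bifurcation (hf₁ : f₁.IsHomogeneous d) (hg₀ : g₀.IsHomogeneous d)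
    (hg₂ : g₂.IsHomogeneous d) (hD : IsSymmetricA3Datum f₁ g₀ g₂ j k a) :
    ∃ (εa εb : ℝ) (ψ : ℂ → ℂ), IsSymmetricA3Bifurcation f₁ g₀ g₂ j a εa εb ψ := by
  classical
  have hjk : j ≠ k := hD.1
  -- the reduced chart
  obtain ⟨D, xs, s, hDo, h0D, hxsA, hsd, hxs0, hchart, hrefl, hks, -, hgrad, ρu, hρu, huniq⟩ :=
    hD.exists_reducedChart hf₁ hg₀ hg₂
  have hxsd : DifferentiableOn ℂ xs D := hxsA.differentiableOn
  -- the Hessian block is non-degenerate near `0`: shrink `D` to a symmetric ball where it is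
  obtain ⟨εB, hεB, hB⟩ := exists_ball_of_eventually
    (eventually_det_block_hessianAt_chart_ne_zero hf₁ hD (hxsA 0 h0D).continuousAt hxs0)
  set D' : Set ((ℂ × ℂ) × ℂ) := D ∩ ball 0 εB with hD'
  have hD'o : IsOpen D' := hDo.inter isOpen_ball
  have h0D' : (0 : (ℂ × ℂ) × ℂ) ∈ D' := ⟨h0D, mem_ball_self hεB⟩
  have hD'D : D' ⊆ D := inter_subset_left
  -- the reduced function, as a function of the pair `(μ, u)`
  set r : (ℂ × ℂ) × ℂ → ℂ := fun q => eval (xs q) (f₁ + q.1.1 • g₂ + q.1.2 • g₀) with hr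
  have hrq : ∀ q, r q = eval (xs q) (f₁ + q.1.1 • g₂ + q.1.2 • g₀) := fun q => rfl
  have hrμ : ∀ (μ : ℂ × ℂ) (u : ℂ), r (μ, u) = eval (xs (μ, u)) (f₁ + μ.1 • g₂ + μ.2 • g₀) := fun _ _ => rfl
  have hrfun : ∀ μ : ℂ × ℂ, (fun v => r (μ, v)) = fun v => eval (xs (μ, v)) (f₁ + μ.1 • g₂ + μ.2 • g₀) :=
    fun _ => rfl
  have hrd : DifferentiableOn ℂ r D' := (reduced_differentiableOn hgrad).mono hD'D
  have heven : ∀ p ∈ D', (p.1, -p.2) ∈ D' ∧ r (p.1, -p.2) = r p := by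
    intro p hp
    obtain ⟨hmem, heq⟩ := reduced_even hg₀ hf₁ hg₂ hD hrefl p hp.1
    refine ⟨⟨hmem, ?_⟩, heq⟩
    have h2 := hp.2
    rw [mem_ball_zero_iff] at h2 ⊢
    simpa [Prod.norm_def, norm_neg] using h2
  have hord : analyticOrderAt (fun u => r (0, u)) 0 = 4 :=
    reduced_analyticOrderAt_eq_four hf₁ hD hDo h0D hxsA hsd hxs0 hchart hks hgrad hrq
  -- even quartic Weierstrass preparation
  obtain ⟨ε, ρ, l₁, l₂, U, hε, hρ, hsub, hl₁, hl₂, hl₁0, hl₂0, hUd, hUne, hfact, hroots⟩ :=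
    exists_even_quartic_preparation hD'o h0D' hrd heven hord
  have hsubD : ∀ {μ : ℂ × ℂ} {u : ℂ}, μ ∈ ball (0 : ℂ × ℂ) ε → u ∈ ball (0 : ℂ) ρ → (μ, u) ∈ D :=
    fun hμ hu => hD'D (hsub (mk_mem_prod hμ hu))
  have hsubB : ∀ {μ : ℂ × ℂ} {u : ℂ}, μ ∈ ball (0 : ℂ × ℂ) ε → u ∈ ball (0 : ℂ) ρ →
      ‖((μ, u) : (ℂ × ℂ) × ℂ)‖ < εB :=
    fun hμ hu => by have h := (hsub (mk_mem_prod hμ hu)).2; rwa [mem_ball_zero_iff] at h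
  -- axis vanishing and the `β`-derivative
  have haxis := reduced_eventually_axis hf₁ hD ⟨ρu, hρu, huniq⟩
  have haxis' : ∀ᶠ α in 𝓝 (0 : ℂ), r ((α, 0), 0) = 0 := haxis.mono fun α h => h.2.2
  obtain ⟨L, hL, hL1⟩ := reduced_hasFDerivAt_zero hD h0D hxs0 hgrad
  -- the two branches
  have hC := eventually_l₂_eq_zero_iff hε hρ hl₂ hUd hUne hfact haxis' hL hL1
  obtain ⟨δ, φ, hδ, hφd, hφ0, hbr⟩ := exists_branch_graph hε hρ hl₁ hl₂ hl₁0 hl₂0 hUd hfact hL hL1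
  -- `∂ᵤ²r ≠ 0` on the punctured axis
  have hsec := reduced_eventually_second_deriv_ne_zero hf₁ hD hDo h0D hxsA hsd hxs0 hchart hks hgrad
  -- far singular points, read in the chart box of radius `ρ₁ = min ρu ρ`
  set ρ₁ : ℝ := min ρu ρ with hρ₁
  have hρ₁0 : 0 < ρ₁ := lt_min hρu hρ
  have hfar := hD.eventually_forall_singular_mem hf₁ hg₀ hg₂ (V := ball (Pi.single j (1 : ℂ)) ρ₁) isOpen_ball
    (mem_ball_self hρ₁0)
  -- radii
  obtain ⟨εC, hεC, hCb⟩ := exists_ball_of_eventually hC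
  obtain ⟨εF, hεF, hFb⟩ := exists_ball_of_eventually hfar
  obtain ⟨εA, hεA, hAb⟩ := exists_ball_of_eventually haxis
  obtain ⟨εS, hεS, hSb⟩ := exists_ball_of_eventually_punctured hsec
  set εμ : ℝ := min (min ε εC) (min δ (min εF ρu)) with hεμ
  have hεμ0 : 0 < εμ := by positivity
  have hεμ_ε : εμ ≤ ε := le_trans (min_le_left _ _) (min_le_left _ _)
  have hεμ_C : εμ ≤ εC := le_trans (min_le_left _ _) (min_le_right _ _)
  have hεμ_δ : εμ ≤ δ := le_trans (min_le_right _ _) (min_le_left _ _)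
  have hεμ_F : εμ ≤ εF := le_trans (min_le_right _ _) (le_trans (min_le_right _ _) (min_le_left _ _))
  have hεμ_u : εμ ≤ ρu := le_trans (min_le_right _ _) (le_trans (min_le_right _ _) (min_le_right _ _))
  -- `φ` is small near `0`
  have hφc : ContinuousAt φ 0 := (hφd.differentiableAt (isOpen_ball.mem_nhds (mem_ball_self hδ))).continuousAt
  obtain ⟨εφ, hεφ, hφb⟩ : ∃ εφ > 0, ∀ α : ℂ, ‖α‖ < εφ → 2 * ‖φ α‖ < εμ := by
    have h : ∀ᶠ α in 𝓝 (0 : ℂ), ‖φ α‖ < εμ / 2 :=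
      hφc.norm.eventually (gt_mem_nhds (show ‖φ 0‖ < εμ / 2 by rw [hφ0, norm_zero]; positivity))
    obtain ⟨εφ, hεφ, hb⟩ := exists_ball_of_eventually h
    exact ⟨εφ, hεφ, fun α hα => by have := hb α hα; linarith⟩
  set εa : ℝ := min εμ (min εS (min εφ εA)) with hεa
  have hεa0 : 0 < εa := by positivity
  have hεa_μ : εa ≤ εμ := min_le_left _ _
  have hεa_S : εa ≤ εS := le_trans (min_le_right _ _) (min_le_left _ _)
  have hεa_φ : εa ≤ εφ := le_trans (min_le_right _ _) (le_trans (min_le_right _ _) (min_le_left _ _))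
  have hεa_A : εa ≤ εA := le_trans (min_le_right _ _) (le_trans (min_le_right _ _) (min_le_right _ _))
  -- bookkeeping for a parameter `μ` with `‖μ‖ < εμ`
  have hμall : ∀ {μ : ℂ × ℂ}, ‖μ‖ < εμ →
      μ ∈ ball (0 : ℂ × ℂ) ε ∧ (l₂ μ = 0 ↔ μ.2 = 0) ∧ μ ∈ ball (0 : ℂ × ℂ) δ ∧ ‖μ‖ < εF ∧ ‖μ‖ < ρu :=
    fun hn => ⟨mem_ball_zero_iff.2 (lt_of_lt_of_le hn hεμ_ε), hCb _ (lt_of_lt_of_le hn hεμ_C),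
      mem_ball_zero_iff.2 (lt_of_lt_of_le hn hεμ_δ), lt_of_lt_of_le hn hεμ_F, lt_of_lt_of_le hn hεμ_u⟩
  have hnormab : ∀ {a' b : ℂ}, ‖a'‖ < εa → ‖b‖ < εμ → ‖((a', b) : ℂ × ℂ)‖ < εμ :=
    fun ha hb => norm_mk_lt (lt_of_lt_of_le ha hεa_μ) hb
  -- SINGULAR ⟹ CRITICAL ZERO in the disc
  have hcrit_of_sing : ∀ {μ : ℂ × ℂ}, ‖μ‖ < εμ → ∀ z : Fin (n + 2) → ℂ, z ≠ 0 →
      (∀ i, eval z (pderiv i (f₁ + μ.1 • g₂ + μ.2 • g₀)) = 0) →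
      z j ≠ 0 ∧ ∃ u ∈ ball (0 : ℂ) ρ, (μ, u) ∈ D ∧ xs (μ, u) = (z j)⁻¹ • z ∧
        r (μ, u) = 0 ∧ deriv (fun v => r (μ, v)) u = 0 := by
    intro μ hμn z hz hsing
    obtain ⟨-, -, -, hF, hU'⟩ := hμall hμn
    obtain ⟨hzj, hxj, hxV, hxsing⟩ := hFb μ hF z hz hsing
    have hxρ₁ : ‖(z j)⁻¹ • z - Pi.single j 1‖ < ρ₁ := by rwa [mem_ball, dist_eq_norm] at hxV
    obtain ⟨hmem, hxs, hzero, hder⟩ := critical_of_singular hf₁ hg₀ hg₂ hD hks hgrad huniq hU'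
      (lt_of_lt_of_le hxρ₁ (min_le_left _ _)) hxj hxsing
    refine ⟨hzj, ((z j)⁻¹ • z) k, ?_, hmem, hxs, ?_, ?_⟩
    · rw [mem_ball_zero_iff]
      have h1 : ‖((z j)⁻¹ • z - (Pi.single j 1 : Fin (n + 2) → ℂ)) k‖ ≤ ‖(z j)⁻¹ • z - Pi.single j 1‖ :=
        norm_le_pi_norm _ k
      have h2 : ((z j)⁻¹ • z - (Pi.single j 1 : Fin (n + 2) → ℂ)) k = ((z j)⁻¹ • z) k := by
        simp [Pi.single_eq_of_ne hjk.symm]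
      rw [h2] at h1
      exact lt_of_le_of_lt h1 (lt_of_lt_of_le hxρ₁ (min_le_right _ _))
    · rw [hrμ]; exact hzero
    · rw [hrfun]; exact hder
  -- CRITICAL ZERO ⟹ SINGULAR
  have hsing_of_crit : ∀ {μ : ℂ × ℂ} {u : ℂ}, μ ∈ ball (0 : ℂ × ℂ) ε → u ∈ ball (0 : ℂ) ρ → r (μ, u) = 0 →
      deriv (fun v => r (μ, v)) u = 0 →
      (∀ i, eval (xs (μ, u)) (pderiv i (f₁ + μ.1 • g₂ + μ.2 • g₀)) = 0) ∧ xs (μ, u) j = 1 := by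
    intro μ u hμ hu hzero hder
    rw [hrμ] at hzero
    rw [hrfun] at hder
    obtain ⟨h1, h2, -⟩ := singular_of_critical hf₁ hg₀ hg₂ hD hchart hks hgrad (hsubD hμ hu) hzero hder
    exact ⟨h1, h2⟩
  -- NODE at a critical zero with `∂ᵤ²r ≠ 0`
  have hnode : ∀ {μ : ℂ × ℂ} {u : ℂ}, μ ∈ ball (0 : ℂ × ℂ) ε → u ∈ ball (0 : ℂ) ρ → r (μ, u) = 0 →
      deriv (fun v => r (μ, v)) u = 0 → iteratedDeriv 2 (fun v => r (μ, v)) u ≠ 0 →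
      IsOrdinaryDoublePointOf (f₁ + μ.1 • g₂ + μ.2 • g₀) (xs (μ, u)) := by
    intro μ u hμ hu hzero hder hsecond
    rw [hrμ] at hzero
    rw [hrfun] at hder hsecond
    have hblock : ((hessianAt (f₁ + μ.1 • g₂ + μ.2 • g₀) (xs (μ, u))).submatrix
        (fun i : {i : Fin (n + 2) // i ≠ j ∧ i ≠ k} => i.1) (fun i : {i : Fin (n + 2) // i ≠ j ∧ i ≠ k} => i.1)).det ≠ 0 := by
      have h := hB _ (hsubB hμ hu)
      simpa only using h
    exact isOrdinaryDoublePointOf_of_critical hf₁ hg₀ hg₂ hD hDo hxsd hchart hks hgrad (hsubD hμ hu) hzero hder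
      hblock hsecond
  -- the axis data for `0 < |a'| < εa`
  have haxis_data : ∀ {a' : ℂ}, ‖a'‖ < εa → a' ≠ 0 →
      (((a', 0) : ℂ × ℂ), (0 : ℂ)) ∈ D ∧ xs ((a', 0), 0) = Pi.single j 1 ∧ r ((a', 0), 0) = 0 ∧
        l₂ (a', 0) = 0 ∧ iteratedDeriv 2 (fun v => r ((a', 0), v)) 0 ≠ 0 ∧
        (∀ u ∈ ball (0 : ℂ) ρ, (r ((a', 0), u) = 0 ∧ deriv (fun v => r ((a', 0), v)) u = 0) ↔ u = 0) ∧
        φ a' ≠ 0 := by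
    intro a' ha ha0
    obtain ⟨hmem, hxs, hzero⟩ := hAb a' (lt_of_lt_of_le ha hεa_A)
    obtain ⟨-, hsecond⟩ := hSb a' (lt_of_lt_of_le ha hεa_S) ha0
    obtain ⟨hε', hCiff, hδ', -, -⟩ := hμall (hnormab ha (by rw [norm_zero]; exact hεμ0))
    have hl₂0' : l₂ (a', 0) = 0 := hCiff.2 rfl
    obtain ⟨-, hnot, honly⟩ := critical_zeros_axis hρ hUd hUne hfact hε' hl₂0' hsecond
    refine ⟨hmem, hxs, hzero, hl₂0', hsecond, honly, fun hφ => hnot ((hbr _ hδ').2 ?_)⟩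
    exact hφ.symm
  refine ⟨εa, εμ, φ, hεa0, hεμ0, hφd.mono (ball_subset_ball (le_trans hεa_μ hεμ_δ)), hφ0,
    fun a' ha ha0 => (haxis_data ha ha0).2.2.2.2.2.2, fun a' ha => hφb a' (lt_of_lt_of_le ha hεa_φ),
    fun a' b ha hb => ?_, fun a' ha ha0 => ⟨?_, ?_⟩⟩
  · -- NONSINGULAR ⟺ `b ∉ {0, ψ a'}`
    obtain ⟨hε', hCiff, hδ', -, -⟩ := hμall (hnormab ha hb)
    constructor
    · intro hns
      refine ⟨fun hb0 => ?_, fun hbφ => ?_⟩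
      · subst hb0
        exact hD.not_isNonsingularForm_axisMember hf₁ a' hns
      · have h4 : 4 * l₂ (a', b) = l₁ (a', b) ^ 2 := (hbr _ hδ').2 hbφ
        obtain ⟨u, hu, hzero, hder⟩ := (exists_critical_zero_iff hUd hUne hfact hroots hε').2 (Or.inr h4)
        obtain ⟨hsing, hxj⟩ := hsing_of_crit hε' hu hzero hder
        have hsing' : ∀ i, eval (xs ((a', b), u)) (pderiv i (f₁ + a' • g₂ + b • g₀)) = 0 := by
          simpa only using hsing
        have hx0 : xs ((a', b), u) ≠ 0 := by
          intro h0
          have h1 : xs ((a', b), u) j = 0 := by rw [h0]; rfl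
          rw [hxj] at h1
          exact one_ne_zero h1
        have hFx : eval (xs ((a', b), u)) (f₁ + a' • g₂ + b • g₀) = 0 := by
          have h := hzero
          rw [hrμ] at h
          simpa only using h
        rw [SmoothHypersurface.isNonsingularForm_iff_forall_exists_eval_pderiv_ne_zero] at hns
        obtain ⟨i, hi⟩ := hns _ hx0 hFx
        exact hi (hsing' i)
    · rintro ⟨hb0, hbφ⟩
      rw [SmoothHypersurface.isNonsingularForm_iff_forall_exists_eval_pderiv_ne_zero]
      intro z hz _
      by_contra hall
      have hall₀ : ∀ i, eval z (pderiv i (f₁ + a' • g₂ + b • g₀)) = 0 := fun i => not_not.1 fun h => hall ⟨i, h⟩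
      have hall' : ∀ i, eval z (pderiv i (f₁ + ((a', b) : ℂ × ℂ).1 • g₂ + ((a', b) : ℂ × ℂ).2 • g₀)) = 0 := by
        simpa only using hall₀
      obtain ⟨-, u, hu, -, -, hzero, hder⟩ := hcrit_of_sing (hnormab ha hb) z hz hall'
      rcases (exists_critical_zero_iff hUd hUne hfact hroots hε').1 ⟨u, hu, hzero, hder⟩ with h0 | h4
      · exact hb0 (hCiff.1 h0)
      · exact hbφ ((hbr _ hδ').1 h4)
  · -- the member `b = 0`: exactly one node, at `e_j`
    obtain ⟨hmem, hxs, hzero, hl₂0', hsecond, honly, -⟩ := haxis_data ha ha0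
    obtain ⟨hε', -, -, -, -⟩ := hμall (hnormab ha (by rw [norm_zero]; exact hεμ0))
    have h0ρ : (0 : ℂ) ∈ ball (0 : ℂ) ρ := mem_ball_self hρ
    have hder0 : deriv (fun v => r ((a', 0), v)) 0 = 0 := ((honly 0 h0ρ).2 rfl).2
    have hODP := hnode hε' h0ρ hzero hder0 hsecond
    have hODP' : IsOrdinaryDoublePointOf (f₁ + a' • g₂) (Pi.single j 1) := by
      rw [hxs] at hODP
      simpa only [zero_smul, add_zero] using hODP
    refine ⟨fun i => ?_, fun i i' _ => Subsingleton.elim i i', fun z hz hsing => ⟨0, z j, ?_⟩⟩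
    · fin_cases i; simpa using hODP'
    · have hsing' : ∀ i, eval z (pderiv i (f₁ + ((a', (0 : ℂ)) : ℂ × ℂ).1 • g₂ + ((a', (0 : ℂ)) : ℂ × ℂ).2 • g₀)) = 0 :=
        fun i => by simpa only [zero_smul, add_zero] using hsing i
      obtain ⟨hzj, u, hu, -, hxsu, hzero', hder'⟩ :=
        hcrit_of_sing (hnormab ha (by rw [norm_zero]; exact hεμ0)) z hz hsing'
      have hu0 : u = 0 := (honly u hu).1 ⟨hzero', hder'⟩
      rw [hu0, hxs] at hxsu
      have : z = z j • (Pi.single j (1 : ℂ) : Fin (n + 2) → ℂ) := by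
        rw [hxsu, smul_smul, mul_inv_cancel₀ hzj, one_smul]
      simpa using this
  · -- the member `b = ψ a'`: two nodes exchanged by `a`
    obtain ⟨-, -, -, -, -, -, hφne⟩ := haxis_data ha ha0
    have hb : ‖φ a'‖ < εμ := by have := hφb a' (lt_of_lt_of_le ha hεa_φ); linarith [norm_nonneg (φ a')]
    obtain ⟨hε', hCiff, hδ', -, -⟩ := hμall (hnormab ha hb)
    have hl₂ne : l₂ (a', φ a') ≠ 0 := fun h => hφne (hCiff.1 h)
    have h4 : 4 * l₂ (a', φ a') = l₁ (a', φ a') ^ 2 := (hbr _ hδ').2 rfl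
    obtain ⟨u₀, hu₀ne, hu₀, hnu₀, hiff, hsec₀, hsec₁⟩ := critical_zeros_branch hUd hUne hfact hroots hε' h4 hl₂ne
    have hc₀ := (hiff u₀ hu₀).2 (Or.inl rfl)
    have hc₁ := (hiff (-u₀) hnu₀).2 (Or.inr rfl)
    have hODP₀ : IsOrdinaryDoublePointOf (f₁ + a' • g₂ + φ a' • g₀) (xs ((a', φ a'), u₀)) := by
      simpa only using hnode hε' hu₀ hc₀.1 hc₀.2 hsec₀
    have hODP₁ : IsOrdinaryDoublePointOf (f₁ + a' • g₂ + φ a' • g₀) (xs ((a', φ a'), -u₀)) := by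
      simpa only using hnode hε' hnu₀ hc₁.1 hc₁.2 hsec₁
    have hx₀j : xs ((a', φ a'), u₀) j = 1 := (hchart _ (hsubD hε' hu₀)).1
    have hx₁j : xs ((a', φ a'), -u₀) j = 1 := (hchart _ (hsubD hε' hnu₀)).1
    have hx₀k : xs ((a', φ a'), u₀) k = u₀ := (hchart _ (hsubD hε' hu₀)).2.1
    have hx₁k : xs ((a', φ a'), -u₀) k = -u₀ := (hchart _ (hsubD hε' hnu₀)).2.1
    -- the two nodes are not proportional
    have key : ∀ t : ℂ, xs ((a', φ a'), u₀) = t • xs ((a', φ a'), -u₀) → False := by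
      intro t ht
      have hj' := congr_fun ht j
      rw [Pi.smul_apply, smul_eq_mul, hx₀j, hx₁j, mul_one] at hj'
      have hk' := congr_fun ht k
      rw [Pi.smul_apply, smul_eq_mul, hx₀k, hx₁k, ← hj', one_mul] at hk'
      exact hu₀ne (by linear_combination hk' / 2)
    have key' : ∀ t : ℂ, xs ((a', φ a'), -u₀) = t • xs ((a', φ a'), u₀) → False := by
      intro t ht
      have hj' := congr_fun ht j
      rw [Pi.smul_apply, smul_eq_mul, hx₀j, hx₁j, mul_one] at hj'
      have hk' := congr_fun ht k
      rw [Pi.smul_apply, smul_eq_mul, hx₀k, hx₁k, ← hj', one_mul] at hk'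
      exact hu₀ne (by linear_combination -hk' / 2)
    refine ⟨![xs ((a', φ a'), u₀), xs ((a', φ a'), -u₀)], ⟨fun i => ?_, fun i i' hii' => ?_, fun z hz hsing => ?_⟩,
      (a j : ℂ), ?_⟩
    · fin_cases i
      · simpa using hODP₀
      · simpa using hODP₁
    · obtain ⟨t, ht⟩ := hii'
      fin_cases i <;> fin_cases i'
      · rfl
      · exact (key t (by simpa using ht)).elim
      · exact (key' t (by simpa using ht)).elim
      · rfl
    · -- every singular vector is one of the two nodes
      have hsing' : ∀ i, eval z (pderiv i (f₁ + ((a', φ a') : ℂ × ℂ).1 • g₂ + ((a', φ a') : ℂ × ℂ).2 • g₀)) = 0 :=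
        fun i => by simpa only using hsing i
      obtain ⟨hzj, u, hu, -, hxsu, hzero', hder'⟩ := hcrit_of_sing (hnormab ha hb) z hz hsing'
      have hz' : z = z j • ((z j)⁻¹ • z) := by rw [smul_smul, mul_inv_cancel₀ hzj, one_smul]
      rcases (hiff u hu).1 ⟨hzero', hder'⟩ with rfl | rfl
      · refine ⟨0, z j, ?_⟩
        simp only [Matrix.cons_val_zero]
        rw [hxsu]; exact hz'
      · refine ⟨1, z j, ?_⟩
        simp only [Matrix.cons_val_one, Matrix.cons_val_zero]
        rw [hxsu]; exact hz'
    · -- exchanged by the involution: `a • q 0 = a_j • q 1`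
      have hneg : xs ((((a', φ a') : ℂ × ℂ), -u₀)) = (a j : ℂ) • (a • xs ((a', φ a'), u₀)) :=
        (hrefl _ (hsubD hε' hu₀)).2
      show a • xs ((a', φ a'), u₀) = (a j : ℂ) • xs ((a', φ a'), -u₀)
      rw [hneg, smul_smul, hD.coe_mul_self j, one_smul]

/-- **F-B2PL from its Picard–Lefschetz half.**  Since the bifurcation half is now a theorem, hB2 =
`picardLefschetz_symmetricA3` follows from hB2-PL alone: for every symmetric `A₃` datum and every bifurcation datum
`(εa, εb, ψ)` of it, the Picard–Lefschetz clauses (ii) for `ψ` on some radius `0 < εa' ≤ εa`.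
[cite: ArnoldGuseinzadeVarchenko2012, Part I §5.2, §2.9 Thm. 2.15, §2.8 Thm. 2.14] [cite: VoisinHodgeII2003, §3.2.1 Thm. 3.16] -/
theorem picardLefschetz_symmetricA3_of_PL
    (hPL : ∀ (n d : ℕ) (f₁ g₀ g₂ : MvPolynomial (Fin (n + 2)) ℂ) (j k : Fin (n + 2)) (a : Fin (n + 2) → ℂˣ),
      f₁.IsHomogeneous d → g₀.IsHomogeneous d → g₂.IsHomogeneous d → IsSymmetricA3Datum f₁ g₀ g₂ j k a →
      ∀ (εa εb : ℝ) (ψ : ℂ → ℂ), IsSymmetricA3Bifurcation f₁ g₀ g₂ j a εa εb ψ →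
        ∃ εa' : ℝ, 0 < εa' ∧ εa' ≤ εa ∧ SymmetricA3PicardLefschetzClauses n d f₁ g₀ g₂ ψ εa') :
    picardLefschetz_symmetricA3 :=
  picardLefschetz_symmetricA3_of_bifurcation
    (fun _ _ _ _ _ _ _ _ hf₁ hg₀ hg₂ hD => hD.exists_isSymmetricA3Bifurcation hf₁ hg₀ hg₂) hPL

end IsSymmetricA3Datum

end HodgeTheory

end Literature.AlgebraicGeometry.HodgeTheory

end
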